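import Literature.Geometry.Manifold.FreeCircleQuotientProjection
import HarnessLib

/-!
# The orbit map of a free smooth circle action is a principal `S¹`-bundle

Fifth file of the package on free smooth circle actions (`FreeCircleAction.lean`,
`FreeCircleFlowBox.lean`, `FreeCircleQuotient.lean`, `FreeCircleQuotientProjection.lean`).
Lee, *Introduction to Smooth Manifolds*, 2nd ed., Thm. 21.10 (and Problem 21-6: the quotient
map of a free proper smooth action is a smooth principal bundle); for the null fibration of an
origami form this is the "principal `S¹`-fibration" of Cannas da Silva–Guillemin–Pires, Def. 2.2.
From slice data `d : CircleSliceData E F p` (slice `param`, transversal coordinate `coord`,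
tube `T`, chart `chart` of `N/S¹`):

* `CircleSliceData.triv (u, a) = a • param u` — the local trivialisation `F × S¹ → N`;
  `angle`, `trivInv a₀` — its inverse on the translate `a₀ • T` of the tube
  (`exp_angle_smul_param_coord`: `z = exp (angle z) • param (coord z)` on `T`;
  `coord_smul_param`: the slice meets each orbit once, multiplicatively);
* `triv_image_eq` (`triv (dom × S¹) = π⁻¹(chart source)`), `injOn_triv`, `triv_mul`
  (equivariance), `circleQuotientMk_triv` (`π ∘ triv = chart⁻¹ ∘ fst`);
* **`CircleSliceData.trivHomeo : OpenPartialHomeomorph (F × Circle) N`** — the local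
  trivialisation as an open partial homeomorphism `dom × S¹ ≃ π⁻¹(chart source)`, with
  `contMDiffOn_triv`, `contMDiffOn_trivHomeo_symm` (`C^∞` both ways);
* **`exists_local_trivialization_circleQuotientMk`** — packaged: about every orbit, an
  `S¹`-equivariant `C^∞` trivialisation of `π` over the chart domain.

Everything here is proved; the definitions are concrete; no facts.

## References

* J. M. Lee, *Introduction to Smooth Manifolds*, 2nd ed., Springer GTM 218 (2012), Thm. 21.10,
  Problem 21-6. [LeeSmoothManifolds2013]
* A. Cannas da Silva, V. Guillemin, A. R. Pires, *Symplectic Origami*, IMRN 2011 =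
  arXiv:0909.4065, Def. 2.2. [CannasdasilvaGuilleminPires2010]
-/

noncomputable section

open Set Filter Function TopologicalSpace Topology
open scoped Manifold ContDiff Topology

namespace Literature.Geometry.Manifold

namespace CircleSliceData

variable {E : Type*} [NormedAddCommGroup E] [NormedSpace ℝ E] {N : Type*} [TopologicalSpace N]
  [ChartedSpace E N] [MulAction Circle N]
  {F : Type*} [NormedAddCommGroup F] [NormedSpace ℝ F] {p : N} (d : CircleSliceData E F p)

/-! ### The local trivialisation defined by a slice -/

/-- The **local trivialisation of `π` defined by a slice**: `(u, a) ↦ a • param u`, from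
`F × S¹` to `N`. [cite: LeeSmoothManifolds2013, Thm. 21.10] -/
def triv (x : F × Circle) : N := x.2 • d.param x.1

/-- The **angle** of a tube point: `z = exp (angle z) • param (coord z)` for `z` in the tube.
[folklore] -/
def angle (z : N) : ℝ := d.ℓ (d.ψ z - d.ψ p)

/-- The candidate inverse of the trivialisation on the translate `a₀ • T` of the tube. [folklore] -/
def trivInv (a₀ : Circle) (y : N) : F × Circle :=
  (d.coord (a₀⁻¹ • y), a₀ * Circle.exp (d.angle (a₀⁻¹ • y)))

/-- `triv (u, a) = a • param u`. [folklore] -/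
@[simp] theorem triv_apply (u : F) (a : Circle) : d.triv (u, a) = a • d.param u := rfl

/-- `π (a • param u) = π (param u)`. [folklore] -/
theorem circleQuotientMk_triv (x : F × Circle) :
    circleQuotientMk (d.triv x) = circleQuotientMk (d.param x.1) :=
  circleQuotientMk_smul _ _

/-- **Retraction, multiplicative form**: `exp (angle z) • param (coord z) = z` on the tube. [folklore] -/
theorem exp_angle_smul_param_coord {z : N} (hz : z ∈ d.T) :
    Circle.exp (d.angle z) • d.param (d.coord z) = z := by
  have h3 := (d.retract z hz).2.2
  have hpc : d.param (d.coord z) = Circle.exp (-d.angle z) • z := by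
    simp only [angle]
    rw [h3]
    simp only [param, coord, ContinuousLinearEquiv.symm_apply_apply, coe_proj]
  rw [hpc, smul_smul, ← Circle.exp_add, add_neg_cancel, Circle.exp_zero, one_smul]

/-- **The slice meets each orbit once, multiplicative form**: if `b • param u` lies in the tube
(`u ∈ dom`) then its coordinate is `u` and its angle recovers `b`. [folklore] -/
theorem coord_smul_param {u : F} (hu : u ∈ d.dom) {b : Circle} (hb : b • d.param u ∈ d.T) :
    d.coord (b • d.param u) = u ∧ Circle.exp (d.angle (b • d.param u)) = b := by
  set z := b • d.param u with hz
  have hret := d.exp_angle_smul_param_coord hb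
  -- `((exp (angle z))⁻¹ * b) • param u = param (coord z)`
  have hkey : ((Circle.exp (d.angle z))⁻¹ * b) • d.param u = d.param (d.coord z) := by
    rw [mul_smul, ← hz]
    exact (inv_smul_eq_iff.2 hret.symm)
  have hcz : d.coord z ∈ d.dom := d.coord_mem_dom hb
  have honce := d.once _ hu (d.apply_coe_symm u) _ hcz (d.apply_coe_symm (d.coord z)) _ hkey
  refine ⟨?_, ?_⟩
  · exact (d.Φ.symm.injective (Subtype.ext honce.2)).symm
  · have h1 := honce.1
    rw [inv_mul_eq_one] at h1
    exact h1

/-- `triv ∘ trivInv a₀ = id` on the translate `a₀ • T` of the tube. [folklore] -/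
theorem triv_trivInv {a₀ : Circle} {y : N} (hy : a₀⁻¹ • y ∈ d.T) :
    d.triv (d.trivInv a₀ y) = y := by
  simp only [trivInv, triv_apply]
  rw [mul_smul, d.exp_angle_smul_param_coord hy, smul_inv_smul]

/-- `trivInv a₀ ∘ triv = id` at parameters `(u, a)` with `a₀⁻¹ • a • param u` in the tube. [folklore] -/
theorem trivInv_triv {a₀ : Circle} {u : F} (hu : u ∈ d.dom) {a : Circle}
    (h : a₀⁻¹ • a • d.param u ∈ d.T) : d.trivInv a₀ (d.triv (u, a)) = (u, a) := by
  have h' : (a₀⁻¹ * a) • d.param u ∈ d.T := by rwa [mul_smul]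
  obtain ⟨hc, he⟩ := d.coord_smul_param hu h'
  simp only [trivInv, triv_apply]
  rw [← mul_smul, hc, he, mul_inv_cancel_left]

variable [ContinuousSMul Circle N]

/-- The image of the trivialisation is the preimage of the chart source under `π`. [folklore] -/
theorem triv_image_eq :
    d.triv '' (d.dom ×ˢ (univ : Set Circle)) = circleQuotientMk ⁻¹' d.chart.source := by
  ext y
  constructor
  · rintro ⟨⟨u, a⟩, ⟨hu, -⟩, rfl⟩
    rw [mem_preimage, circleQuotientMk_triv, d.chart_source]
    exact ⟨d.param u, (d.param_mem hu).2, rfl⟩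
  · intro hy
    rw [mem_preimage, d.chart_source] at hy
    obtain ⟨z, hzT, hz⟩ := hy
    obtain ⟨a, rfl⟩ := circleQuotientMk_eq_iff.1 hz.symm
    refine ⟨(d.coord z, a * Circle.exp (d.angle z)), ⟨d.coord_mem_dom hzT, mem_univ _⟩, ?_⟩
    rw [triv_apply, mul_smul, d.exp_angle_smul_param_coord hzT]

omit [ContinuousSMul Circle N] in
/-- The trivialisation is injective on `dom × S¹` (slice meets each orbit once, freeness). [folklore] -/
theorem injOn_triv : InjOn d.triv (d.dom ×ˢ (univ : Set Circle)) := by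
  rintro ⟨u, a⟩ ⟨hu, -⟩ ⟨u', a'⟩ ⟨hu', -⟩ h
  simp only [triv_apply] at h
  -- `(a'⁻¹ * a) • param u = param u'`
  have hkey : (a'⁻¹ * a) • d.param u = d.param u' := by
    rw [mul_smul, h, inv_smul_smul]
  have honce := d.once _ hu (d.apply_coe_symm u) _ hu' (d.apply_coe_symm u') _ hkey
  have hu_eq : u = u' := d.Φ.symm.injective (Subtype.ext honce.2)
  have ha_eq : a = a' := by
    have h1 := honce.1
    rw [inv_mul_eq_one] at h1
    exact h1.symm
  rw [hu_eq, ha_eq]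

omit [ContinuousSMul Circle N] in
/-- **Equivariance** of the trivialisation: `triv (u, b * a) = b • triv (u, a)`. [folklore] -/
theorem triv_mul (u : F) (a b : Circle) : d.triv (u, b * a) = b • d.triv (u, a) := by
  simp only [triv_apply, mul_smul]

/-- The trivialisation as a partial equivalence `F × S¹ ≃ π⁻¹(chart source)`. [folklore] -/
def trivPartialEquiv : PartialEquiv (F × Circle) N :=
  d.injOn_triv.toPartialEquiv d.triv (d.dom ×ˢ (univ : Set Circle))

omit [ContinuousSMul Circle N] in
/-- The partial equivalence is the trivialisation map. [folklore] -/
@[simp] theorem trivPartialEquiv_apply (x : F × Circle) : d.trivPartialEquiv x = d.triv x := rfl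

omit [ContinuousSMul Circle N] in
/-- Its source is `dom × S¹`. [folklore] -/
theorem trivPartialEquiv_source : d.trivPartialEquiv.source = d.dom ×ˢ (univ : Set Circle) := rfl

/-- Its target is `π⁻¹(chart source)`. [folklore] -/
theorem trivPartialEquiv_target :
    d.trivPartialEquiv.target = circleQuotientMk ⁻¹' d.chart.source := by
  rw [← d.triv_image_eq]
  rfl

/-- On the translate `a₀ • T` of the tube the inverse of the trivialisation is `trivInv a₀`. [folklore] -/
theorem trivPartialEquiv_symm_apply {a₀ : Circle} {y : N} (hy : a₀⁻¹ • y ∈ d.T) :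
    d.trivPartialEquiv.symm y = d.trivInv a₀ y := by
  have hmem : d.trivInv a₀ y ∈ d.dom ×ˢ (univ : Set Circle) := ⟨d.coord_mem_dom hy, mem_univ _⟩
  have hy' : y ∈ d.trivPartialEquiv.target := by
    rw [trivPartialEquiv_target, mem_preimage, ← d.triv_trivInv hy, circleQuotientMk_triv,
      d.chart_source]
    exact ⟨_, (d.param_mem (d.coord_mem_dom hy)).2, rfl⟩
  apply d.injOn_triv (d.trivPartialEquiv.map_target hy') hmem
  rw [d.triv_trivInv hy]
  exact d.trivPartialEquiv.right_inv hy'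

/-- Every point of `π⁻¹(chart source)` lies in a translate `a₀ • T` of the tube. [folklore] -/
theorem exists_inv_smul_mem_T {y : N} (hy : y ∈ circleQuotientMk ⁻¹' d.chart.source) :
    ∃ a₀ : Circle, a₀⁻¹ • y ∈ d.T := by
  rw [mem_preimage, d.chart_source] at hy
  obtain ⟨z, hzT, hz⟩ := hy
  obtain ⟨a, rfl⟩ := circleQuotientMk_eq_iff.1 hz.symm
  exact ⟨a, by rwa [inv_smul_smul]⟩

/-- The trivialisation is continuous on `dom × S¹`. [folklore] -/
theorem continuousOn_triv : ContinuousOn d.triv (d.dom ×ˢ (univ : Set Circle)) := by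
  have h1 : ContinuousOn (fun x : F × Circle => d.param x.1) (d.dom ×ˢ (univ : Set Circle)) :=
    d.continuousOn_param.comp continuous_fst.continuousOn fun x hx => hx.1
  exact continuous_snd.continuousOn.smul h1

omit [ContinuousSMul Circle N] in
/-- The angle is continuous on the tube. [folklore] -/
theorem continuousOn_angle : ContinuousOn d.angle d.T :=
  d.ℓ.continuous.comp_continuousOn ((d.ψ.continuousOn.mono d.hTψ).sub continuousOn_const)

/-- The translate `{y | a₀⁻¹ • y ∈ T}` of the tube is open. [folklore] -/
theorem isOpen_setOf_inv_smul_mem (a₀ : Circle) : IsOpen {y : N | a₀⁻¹ • y ∈ d.T} :=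
  d.hTo.preimage (continuous_const_smul a₀⁻¹)

/-- `trivInv a₀` is continuous on the translate `a₀ • T` of the tube. [folklore] -/
theorem continuousOn_trivInv (a₀ : Circle) : ContinuousOn (d.trivInv a₀) {y : N | a₀⁻¹ • y ∈ d.T} := by
  have hs : Continuous fun y : N => a₀⁻¹ • y := continuous_const_smul a₀⁻¹
  refine ContinuousOn.prodMk ?_ ?_
  · exact d.continuousOn_coord.comp hs.continuousOn fun y hy => hy
  · exact (continuous_const_mul a₀).comp_continuousOn
      (Circle.exp.continuous.comp_continuousOn (d.continuousOn_angle.comp hs.continuousOn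
        fun y hy => hy))

/-- **The local trivialisation of `π : N → N/S¹` defined by a slice**, as an open partial
homeomorphism `F × S¹ ⊇ dom × S¹ ≃ π⁻¹(chart source) ⊆ N`, `(u, a) ↦ a • param u`; it is
`S¹`-equivariant (`triv_mul`) and lifts the inverse chart (`circleQuotientMk_triv`:
`π (triv (u, a)) = chart⁻¹ u`). Lee 2012, Thm. 21.10 (the quotient map of a free proper action
is a principal bundle). [cite: LeeSmoothManifolds2013, Thm. 21.10] -/
def trivHomeo : OpenPartialHomeomorph (F × Circle) N where
  toPartialEquiv := d.trivPartialEquiv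
  open_source := d.isOpen_dom.prod isOpen_univ
  open_target := by
    rw [trivPartialEquiv_target]
    exact d.chart.open_source.preimage continuous_circleQuotientMk
  continuousOn_toFun := d.continuousOn_triv
  continuousOn_invFun := by
    intro y hy
    have hy' : y ∈ circleQuotientMk ⁻¹' d.chart.source := by rwa [← trivPartialEquiv_target]
    obtain ⟨a₀, ha₀⟩ := d.exists_inv_smul_mem_T hy'
    have hO : {y : N | a₀⁻¹ • y ∈ d.T} ∈ 𝓝 y := (d.isOpen_setOf_inv_smul_mem a₀).mem_nhds ha₀
    have hcont : ContinuousAt (d.trivInv a₀) y := (d.continuousOn_trivInv a₀).continuousAt hO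
    refine (hcont.continuousWithinAt (s := d.trivPartialEquiv.target)).congr_of_eventuallyEq
      ?_ (d.trivPartialEquiv_symm_apply ha₀)
    filter_upwards [mem_nhdsWithin_of_mem_nhds hO] with y' hy'
    exact d.trivPartialEquiv_symm_apply hy'

/-- The local trivialisation is the map `triv`. [folklore] -/
@[simp] theorem trivHomeo_apply (x : F × Circle) : d.trivHomeo x = d.triv x := rfl

/-- Its source is `dom × S¹`. [folklore] -/
theorem trivHomeo_source : d.trivHomeo.source = d.dom ×ˢ (univ : Set Circle) := rfl

/-- Its target is `π⁻¹(chart source)`. [folklore] -/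
theorem trivHomeo_target : d.trivHomeo.target = circleQuotientMk ⁻¹' d.chart.source :=
  d.trivPartialEquiv_target

/-- On `a₀ • T` the inverse of the local trivialisation is `trivInv a₀`. [folklore] -/
theorem trivHomeo_symm_apply {a₀ : Circle} {y : N} (hy : a₀⁻¹ • y ∈ d.T) :
    d.trivHomeo.symm y = d.trivInv a₀ y :=
  d.trivPartialEquiv_symm_apply hy

/-! #### Smoothness -/

omit [ContinuousSMul Circle N] in
/-- The trivialisation is `C^∞` on `dom × S¹`. [folklore] -/
theorem contMDiffOn_triv (hθ : ContMDiff ((𝓡 1).prod 𝓘(ℝ, E)) 𝓘(ℝ, E) ∞ (fun x : Circle × N => x.1 • x.2)) :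
    ContMDiffOn (𝓘(ℝ, F).prod (𝓡 1)) 𝓘(ℝ, E) ∞ d.triv (d.dom ×ˢ (univ : Set Circle)) := by
  have hin : ContMDiffOn (𝓘(ℝ, F).prod (𝓡 1)) ((𝓡 1).prod 𝓘(ℝ, E)) ∞
      (fun x : F × Circle => (x.2, d.param x.1)) (d.dom ×ˢ (univ : Set Circle)) :=
    contMDiff_snd.contMDiffOn.prodMk
      (d.contMDiffOn_param.comp contMDiff_fst.contMDiffOn fun x hx => hx.1)
  exact hθ.comp_contMDiffOn hin

omit [ContinuousSMul Circle N] in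
/-- The angle is `C^∞` on the tube. [folklore] -/
theorem contMDiffOn_angle : ContMDiffOn 𝓘(ℝ, E) 𝓘(ℝ, ℝ) ∞ d.angle d.T := by
  have hB : ContMDiff 𝓘(ℝ, E) 𝓘(ℝ, ℝ) ∞ (fun z : E => d.ℓ (z - d.ψ p)) := by
    rw [contMDiff_iff_contDiff]
    exact d.ℓ.contDiff.comp (contDiff_id.sub contDiff_const)
  exact hB.comp_contMDiffOn ((contMDiffOn_of_mem_maximalAtlas d.hψ).mono d.hTψ)

omit [ContinuousSMul Circle N] in
/-- `trivInv a₀` is `C^∞` on the translate `a₀ • T` of the tube. [folklore] -/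
theorem contMDiffOn_trivInv (hθ : ContMDiff ((𝓡 1).prod 𝓘(ℝ, E)) 𝓘(ℝ, E) ∞ (fun x : Circle × N => x.1 • x.2))
    (a₀ : Circle) :
    ContMDiffOn 𝓘(ℝ, E) (𝓘(ℝ, F).prod (𝓡 1)) ∞ (d.trivInv a₀) {y : N | a₀⁻¹ • y ∈ d.T} := by
  have hs : ContMDiff 𝓘(ℝ, E) 𝓘(ℝ, E) ∞ (fun y : N => a₀⁻¹ • y) :=
    hθ.comp (contMDiff_const.prodMk contMDiff_id)
  refine ContMDiffOn.prodMk ?_ ?_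
  · exact d.contMDiffOn_coord.comp hs.contMDiffOn fun y hy => hy
  · have hang : ContMDiffOn 𝓘(ℝ, E) 𝓘(ℝ, ℝ) ∞ (fun y : N => d.angle (a₀⁻¹ • y))
        {y : N | a₀⁻¹ • y ∈ d.T} :=
      d.contMDiffOn_angle.comp hs.contMDiffOn fun y hy => hy
    have hexp := (contMDiff_circleExp (m := ∞)).comp_contMDiffOn hang
    exact (contMDiff_mul_left (a := a₀)).comp_contMDiffOn hexp

/-- The inverse of the local trivialisation is `C^∞` on its domain `π⁻¹(chart source)`
(locally it is `trivInv a₀`). [folklore] -/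
theorem contMDiffOn_trivHomeo_symm
    (hθ : ContMDiff ((𝓡 1).prod 𝓘(ℝ, E)) 𝓘(ℝ, E) ∞ (fun x : Circle × N => x.1 • x.2)) :
    ContMDiffOn 𝓘(ℝ, E) (𝓘(ℝ, F).prod (𝓡 1)) ∞ d.trivHomeo.symm d.trivHomeo.target := by
  apply contMDiffOn_of_locally_contMDiffOn
  intro y hy
  rw [trivHomeo_target] at hy
  obtain ⟨a₀, ha₀⟩ := d.exists_inv_smul_mem_T hy
  refine ⟨{y : N | a₀⁻¹ • y ∈ d.T}, d.isOpen_setOf_inv_smul_mem a₀, ha₀, ?_⟩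
  exact ((d.contMDiffOn_trivInv hθ a₀).mono inter_subset_right).congr
    fun y' hy' => d.trivHomeo_symm_apply hy'.2

end CircleSliceData

/-! ### `π : N → N/S¹` is a principal `S¹`-bundle -/

section Bundle

variable {k : ℕ} {N : Type*} [TopologicalSpace N] [ChartedSpace (EuclideanSpace ℝ (Fin k)) N]
  [IsManifold (𝓡 k) ∞ N] [T2Space N] [MulAction Circle N]
  {F : Type*} [NormedAddCommGroup F] [NormedSpace ℝ F] [FiniteDimensional ℝ F]

/-- **The orbit map of a free smooth circle action is a smooth principal `S¹`-bundle** (Lee 2012,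
Thm. 21.10; for the null fibration of an origami form, Cannas da Silva–Guillemin–Pires Def. 2.2:
"a principal `S¹`-fibration"): about every orbit `q₀` there are an open set `W ∋ q₀` of `N/S¹`
and an `S¹`-equivariant `C^∞` diffeomorphism `Ψ` (an open partial homeomorphism, `C^∞` with
`C^∞` inverse on its domains) from `(chart W) × S¹` onto `π⁻¹(W)` over the chart:
`π (Ψ (u, a)) = chart⁻¹ u`, `Ψ (u, b * a) = b • Ψ (u, a)`. [cite: LeeSmoothManifolds2013, Thm. 21.10] -/
theorem exists_local_trivialization_circleQuotientMk
    (hθ : ContMDiff ((𝓡 1).prod (𝓡 k)) (𝓡 k) ∞ (fun x : Circle × N => x.1 • x.2))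
    (hfree : ∀ (a : Circle) (x : N), a • x = x → a = 1)
    (hF : Module.finrank ℝ F + 1 = k) (q₀ : CircleQuotient N) :
    letI := circleQuotientChartedSpace F hθ hfree hF
    ∃ Ψ : OpenPartialHomeomorph (F × Circle) N,
      Ψ.source = (chartAt F q₀).target ×ˢ (univ : Set Circle) ∧
      Ψ.target = circleQuotientMk ⁻¹' (chartAt F q₀).source ∧
      ContMDiffOn (𝓘(ℝ, F).prod (𝓡 1)) (𝓡 k) ∞ Ψ Ψ.source ∧
      ContMDiffOn (𝓡 k) (𝓘(ℝ, F).prod (𝓡 1)) ∞ Ψ.symm Ψ.target ∧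
      (∀ (u : F) (a : Circle), (u, a) ∈ Ψ.source →
        circleQuotientMk (Ψ (u, a)) = (chartAt F q₀).symm u) ∧
      (∀ (u : F) (a b : Circle), Ψ (u, b * a) = b • Ψ (u, a)) := by
  letI := circleQuotientChartedSpace F hθ hfree hF
  haveI : ContinuousSMul Circle N := ⟨hθ.continuous⟩
  set d : CircleSliceData (EuclideanSpace ℝ (Fin k)) F q₀.out := circleSliceDataAt hθ hfree hF q₀.out
    with hd
  have hchart : chartAt F q₀ = d.chart := rfl
  refine ⟨d.trivHomeo, ?_, ?_, d.contMDiffOn_triv hθ, d.contMDiffOn_trivHomeo_symm hθ, ?_,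
    fun u a b => d.triv_mul u a b⟩
  · rw [d.trivHomeo_source, hchart, d.chart_target]
  · rw [d.trivHomeo_target, hchart]
  · intro u a _
    rw [d.trivHomeo_apply, d.circleQuotientMk_triv, hchart, d.chart_symm_apply]

end Bundle

end Literature.Geometry.Manifold

end
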